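import Literature.AnabelianGeometry.SemiGraphs.ProSigmaCompletionRestrict
import Literature.AnabelianGeometry.SemiGraphs.ProSigmaCompletionInjective
import Literature.AnabelianGeometry.AbsoluteAnabelian.FreeProlCyclicEncoding
import HarnessLib

/-!
# Pro-`Σ` completions of discrete groups, IV: restriction to a subgroup with COFINAL `Σ`-traces

Continuation of `ProSigmaCompletionRestrict.lean` (part III: restriction to an OPEN subgroup) over
abc-iut-L3-t1's interface `SemiGraphOfAnabelioids.IsProSigmaCompletion Sigma ι` ([SemiAnbd] Example 2.10,
«the maximal pro-`Σ` quotient of the fundamental group of a hyperbolic Riemann surface of finite type»,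
p. 31) [cite: MochizukiSemiAnbd2006, Ex. 2.10 p.31].  Theorems only, no definitions.

**Main result** (`IsProSigmaCompletion.closure_map_of_cofinal`).  Let `ι : Γ → P` exhibit the profinite
group `P` as the pro-`Σ` completion of `Γ`, and let `Δ ⊆ Γ` be a subgroup whose normal subgroups of
`Σ`-integer index are COFINAL WITH THE TRACES of those of `Γ`: every `N ⊴ Δ` of `Σ`-integer index contains
`M ∩ Δ` for some `M ⊴ Γ` of `Σ`-integer index.  Then `ι|_Δ : Δ → closure ι(Δ)` exhibits the CLOSED subgroup
`closure ι(Δ) ⊆ P` as the pro-`Σ` completion of `Δ` (dense image; open subgroups of `Σ`-integer index —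
a closed subgroup of a pro-`Σ` group, `isSigmaInteger_index_of_isOpen_of_isProSigma`; universality — the
trace `N` of `M` is the pull-back of `ι(N)·(W ∩ closure ι(Δ))` for an open NORMAL `W ⊆ P` inside the open
pull-back realising `M`).  This is the input for DPSC data of DEGENERATING shape (a vertex group
`Π_v = closure ι(Γ_v)` inside the pro-`Σ` completion of the fundamental group of the whole graph of
groups, or the geometric part `Π_𝔾 = closure ι(Γ_𝔾)` inside the pro-`Σ` completion of an extension
`Γ_𝔾 ⋊ ℤ`): there the cofinality is supplied by finite generation of `Γ_v` / the Dehn-twist action having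
`Σ`-power order on `Σ`-quotients.  Plain (pro)finite group theory; nothing here takes a side on [IUTchIII]
Cor. 3.12.
-/

namespace Literature.AnabelianGeometry.SemiGraphs.SemiGraphOfAnabelioids.IsProSigmaCompletion

open Literature.AnabelianGeometry.Anabelioids Topology
open scoped Pointwise

variable {Sigma : Set ℕ} {Γ : Type*} [Group Γ] {P : Type*} [Group P] [TopologicalSpace P]
  [IsTopologicalGroup P] [CompactSpace P] [TotallyDisconnectedSpace P] {ι : Γ →* P}

omit [CompactSpace P] [TotallyDisconnectedSpace P] in
/-- The image of `ι|_Δ : Δ → closure ι(Δ)` is dense. [cite: MochizukiSemiAnbd2006, Ex. 2.10 p.31] -/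
theorem dense_range_inclusion_comp_subgroupMap (Δ : Subgroup Γ) :
    Dense (Set.range ((Subgroup.inclusion (Subgroup.le_topologicalClosure (Δ.map ι))).comp
      (ι.subgroupMap Δ))) := by
  set C := (Δ.map ι).topologicalClosure with hC
  set f := (Subgroup.inclusion (Subgroup.le_topologicalClosure (Δ.map ι))).comp (ι.subgroupMap Δ)
    with hf
  have hval : ((↑) : ↥C → P) '' Set.range f = (Δ.map ι : Set P) := by
    ext y
    constructor
    · rintro ⟨_, ⟨x, rfl⟩, rfl⟩
      exact ⟨x, x.2, rfl⟩
    · rintro ⟨x, hx, rfl⟩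
      exact ⟨f ⟨x, hx⟩, ⟨⟨x, hx⟩, rfl⟩, rfl⟩
  rw [dense_iff_closure_eq, Topology.IsEmbedding.subtypeVal.closure_eq_preimage_closure_image, hval,
    ← Subgroup.topologicalClosure_coe]
  exact Subtype.coe_preimage_self _

/-- **Pro-`Σ` completions restrict to subgroups with cofinal `Σ`-traces.**  If `ι : Γ → P` is a pro-`Σ`
completion (`P` profinite) and every normal subgroup `N ⊴ Δ` of `Σ`-integer index contains `M ∩ Δ` for some
normal `M ⊴ Γ` of `Σ`-integer index, then `ι|_Δ : Δ → closure ι(Δ)` is a pro-`Σ` completion of `Δ`.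
[cite: MochizukiSemiAnbd2006, Ex. 2.10 p.31] -/
theorem closure_map_of_cofinal (hι : IsProSigmaCompletion Sigma ι) (Δ : Subgroup Γ)
    (hcof : ∀ N : Subgroup Δ, N.Normal → IsSigmaInteger Sigma N.index →
      ∃ M : Subgroup Γ, M.Normal ∧ IsSigmaInteger Sigma M.index ∧ M.subgroupOf Δ ≤ N) :
    IsProSigmaCompletion Sigma ((Subgroup.inclusion (Subgroup.le_topologicalClosure (Δ.map ι))).comp
      (ι.subgroupMap Δ)) := by
  classical
  set C := (Δ.map ι).topologicalClosure with hC
  set f := (Subgroup.inclusion (Subgroup.le_topologicalClosure (Δ.map ι))).comp (ι.subgroupMap Δ)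
    with hf
  have hfval : ∀ x : Δ, ((f x : ↥C) : P) = ι x := fun _ => rfl
  have hP : IsProSigma Sigma P :=
    ⟨fun U _ p hp hdvd => (hι.index_open U.toSubgroup inferInstance U.isOpen').2 p hp hdvd⟩
  refine ⟨dense_range_inclusion_comp_subgroupMap Δ, fun N _ hNo => ?_, fun N hNn hNS => ?_⟩
  · exact AbsoluteAnabelian.isSigmaInteger_index_of_isOpen_of_isProSigma hP C N hNo
  · haveI := hNn
    obtain ⟨M, hMn, hMS, hMN⟩ := hcof N hNn hNS
    haveI := hMn
    obtain ⟨V, hVo, hVM⟩ := hι.comap_surj M hMn hMS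
    -- an open NORMAL subgroup `W ⊆ V` of `P`
    obtain ⟨W, hWV⟩ := ProfiniteGrp.exist_openNormalSubgroup_sub_open_nhds_of_one hVo (one_mem V)
    let WC : Subgroup ↥C := W.toSubgroup.comap C.subtype
    have hWCo : IsOpen (WC : Set ↥C) := W.isOpen'.preimage continuous_subtype_val
    haveI : WC.Normal := Subgroup.normal_comap _
    refine ⟨N.map f ⊔ WC, Subgroup.isOpen_mono le_sup_right hWCo, le_antisymm ?_ ?_⟩
    · intro δ hδ
      rw [Subgroup.mem_comap] at hδ
      have hδ' : (f δ : ↥C) ∈ ((N.map f : Subgroup ↥C) : Set ↥C) * (WC : Set ↥C) := by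
        rw [← Subgroup.mul_normal]
        exact hδ
      obtain ⟨a, ha, w, hw, heq⟩ := Set.mem_mul.mp hδ'
      obtain ⟨n, hn, rfl⟩ := ha
      -- `w = f (n⁻¹ δ) ∈ W ⊆ V`, so `n⁻¹ δ ∈ ι⁻¹(V) = M`, a trace contained in `N`
      have hw' : w = f (n⁻¹ * δ) := by
        rw [map_mul, map_inv, ← heq, inv_mul_cancel_left]
      have hmem : ((n⁻¹ * δ : Δ) : Γ) ∈ M := by
        rw [← hVM, Subgroup.mem_comap, ← hfval]
        rw [hw'] at hw
        exact hWV hw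
      have hN' : n⁻¹ * δ ∈ N := hMN (Subgroup.mem_subgroupOf.mpr hmem)
      have := N.mul_mem hn hN'
      rwa [mul_inv_cancel_left] at this
    · intro n hn
      exact Subgroup.mem_comap.mpr (Subgroup.mem_sup_left ⟨n, hn, rfl⟩)

/-- In particular `ι` is injective on `Δ` when `Δ` is residually `Σ`-finite in the traced sense: the
kernel of `ι|_Δ` lies in every `N ⊴ Δ` of `Σ`-integer index. [cite: MochizukiSemiAnbd2006, Ex. 2.10 p.31] -/
theorem ker_comp_subgroupMap_le_of_cofinal (hι : IsProSigmaCompletion Sigma ι) (Δ : Subgroup Γ)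
    (hcof : ∀ N : Subgroup Δ, N.Normal → IsSigmaInteger Sigma N.index →
      ∃ M : Subgroup Γ, M.Normal ∧ IsSigmaInteger Sigma M.index ∧ M.subgroupOf Δ ≤ N)
    (N : Subgroup Δ) [N.Normal] (hN : IsSigmaInteger Sigma N.index) :
    ((Subgroup.inclusion (Subgroup.le_topologicalClosure (Δ.map ι))).comp (ι.subgroupMap Δ)).ker ≤ N :=
  (closure_map_of_cofinal hι Δ hcof).ker_le_of_isSigmaInteger_index N hN

end Literature.AnabelianGeometry.SemiGraphs.SemiGraphOfAnabelioids.IsProSigmaCompletion
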